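import Summits.NavierStokesRegularity.NavierStokesRegularity.Theorems.Target.Negative.CounterexampleProfile
import Summits.NavierStokesRegularity.NavierStokesRegularity.Theorems.Target.Negative.NormalForms

/-!
# Crux `Target` = `TypeICertificateLadder.NoTypeIBlowup` (stmt-NavierStokesRegularity-1217), negative side:
# the Type-I rate may be assumed on all of `[0, T)`, and the adversary's normal form of a kill

Negative-side (cdisprove, D-0016) structure theorems extracted from the crux work file
`Cruxes/Target/Disproof.lean` §§6b, 6c (gen 3), importable by provers:

* `target_iff_globalRate : Target ↔ TargetGlobalRate` — the eventual rate hypothesis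
  `∀ᶠ t → T⁻` may be replaced by the rate on ALL of `[0, T)` (`globalRate_of_isTypeIBlowup`:
  eventual rate on `(T₁, T)` + the pointwise bound of `CounterexampleProfile.pointwise_bounded_before`
  on an earlier slab ⇒ constant `max C (M√T)`);
* `not_target_iff_unit_witness` — THE ADVERSARY'S NORMAL FORM: `¬ Target` iff some classical
  unit-viscosity `(u, p)` on `[0, 1) × ℝ³`, Leray–Hopf on `[0, 1]` from its rapidly decaying datum,
  with the Type-I rate on ALL of `[0, 1)`, has no classical extension past `1`
  (`NormalForms.target_iff_unit` + `globalRate_of_isTypeIBlowup`).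

Nothing here closes the item (`--supports`). [folklore]
-/

noncomputable section

open MeasureTheory TopologicalSpace Set Function Filter Metric
open scoped Topology RealInnerProductSpace ContDiff Laplacian InnerProductSpace
open Literature.Analysis.FluidPDE

namespace Summit.NavierStokesRegularity.NavierStokesRegularity.Theorems.Target.Negative

/-- Local notation for physical space `ℝ³ = EuclideanSpace ℝ (Fin 3)`. -/
local notation "ℝ³" => EuclideanSpace ℝ (Fin 3)

/-! ## §6b Normal form 2: the Type-I rate may be assumed on all of `[0, T)` (gen 3) -/

section GlobalRate

variable {ν T : ℝ} {u : ℝ → ℝ³ → ℝ³} {p : ℝ → ℝ³ → ℝ}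

/-- The crux with the Type-I hypothesis STRENGTHENED from "eventually as `t ↑ T`" to the whole
life span: `∃ C, ∀ t ∈ [0, T), ∀ x, ‖u(t, x)‖ ≤ C / √(T - t)` (a weaker statement, a priori). -/
def TargetGlobalRate : Prop :=
  ∀ (ν T : ℝ), 0 < ν → 0 < T → ∀ (u : ℝ → ℝ³ → ℝ³) (p : ℝ → ℝ³ → ℝ),
    IsClassicalNSSolutionOn (Set.Ico 0 T) ν 0 u p → IsLerayHopfOn T ν 0 (u 0) u →
    HasRapidSpatialDecay (u 0) → (∃ C : ℝ, ∀ t ∈ Ico 0 T, ∀ x, ‖u t x‖ ≤ C / Real.sqrt (T - t)) →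
    HasSmoothExtensionPast ν 0 u T

/-- **An eventual Type-I rate is a global one** for crux-class solutions: if
`‖u(t, x)‖ ≤ C/√(T - t)` for `t ∈ (T₁, T)` then, `u` being pointwise bounded by some `M` on
`[0, T'] × ℝ³` for a `T' ∈ (T₁, T)` (§4 `pointwise_bounded_before`) and `√(T - t) ≤ √T` there,
the rate holds on all of `[0, T)` with constant `max C (M √T)`. -/
theorem globalRate_of_isTypeIBlowup (hν : 0 < ν) (hT : 0 < T)
    (hcl : IsClassicalNSSolutionOn (Ico 0 T) ν 0 u p) (hLH : IsLerayHopfOn T ν 0 (u 0) u)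
    (hdec : HasRapidSpatialDecay (u 0)) (hI : IsTypeIBlowup u T) :
    ∃ C : ℝ, ∀ t ∈ Ico 0 T, ∀ x, ‖u t x‖ ≤ C / Real.sqrt (T - t) := by
  obtain ⟨C, hC⟩ := hI
  obtain ⟨T₁, hT₁T, hT₁⟩ := mem_nhdsLT_iff_exists_Ioo_subset.1 hC
  have hT₁T' : T₁ < T := hT₁T
  set T' : ℝ := max ((T₁ + T) / 2) 0 with hT'
  have hT'T : T' < T := max_lt (by linarith) hT
  have hT₁T' : T₁ < T' := lt_of_lt_of_le (by linarith) (le_max_left _ _)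
  obtain ⟨M, hM⟩ := pointwise_bounded_before hν hcl hLH hdec T' hT'T
  refine ⟨max C (M * Real.sqrt T), fun t ht x => ?_⟩
  have hpos : 0 < Real.sqrt (T - t) := Real.sqrt_pos.2 (sub_pos.2 ht.2)
  rcases le_or_gt t T' with hle | hlt
  · -- early times: `‖u‖ ≤ M ≤ M √T / √(T - t)`
    have hb := hM t ⟨ht.1, hle⟩ x
    have hM0 : 0 ≤ M := (norm_nonneg _).trans hb
    have hsq : Real.sqrt (T - t) ≤ Real.sqrt T := Real.sqrt_le_sqrt (by linarith [ht.1])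
    calc ‖u t x‖ ≤ M := hb
      _ ≤ M * Real.sqrt T / Real.sqrt (T - t) := by
          rw [le_div_iff₀ hpos]
          exact mul_le_mul_of_nonneg_left hsq hM0
      _ ≤ max C (M * Real.sqrt T) / Real.sqrt (T - t) :=
          div_le_div_of_nonneg_right (le_max_right _ _) hpos.le
  · -- late times: the eventual rate
    calc ‖u t x‖ ≤ C / Real.sqrt (T - t) := hT₁ ⟨hT₁T'.trans hlt, ht.2⟩ x
      _ ≤ max C (M * Real.sqrt T) / Real.sqrt (T - t) :=
          div_le_div_of_nonneg_right (le_max_left _ _) hpos.le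

/-- **Normal form: the Type-I rate may be assumed on the whole life span.** The crux is
equivalent to its version with the rate hypothesis on all of `[0, T)`; provers may start from
`∀ t ∈ [0, T), ‖u(t)‖_∞ ≤ C/√(T - t)` (and, by §6, from `ν = T = 1`). -/
theorem target_iff_globalRate : Target ↔ TargetGlobalRate := by
  constructor
  · intro h ν T hν hT u p hcl hLH hdec hC
    obtain ⟨C, hC⟩ := hC
    refine h ν T hν hT u p hcl hLH hdec ⟨C, ?_⟩
    filter_upwards [Ioo_mem_nhdsLT hT] with t ht x using hC t ⟨ht.1.le, ht.2⟩ x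
  · intro h ν T hν hT u p hcl hLH hdec hI
    exact h ν T hν hT u p hcl hLH hdec (globalRate_of_isTypeIBlowup hν hT hcl hLH hdec hI)

end GlobalRate

/-! ## §6c The adversary's normal form: what a kill IS (gen 3) -/

section KillNormalForm

/-- **Refutation criterion in normal form.** The crux is FALSE iff there is a classical solution
`(u, p)` of unit-viscosity unforced Navier–Stokes on `[0, 1) × ℝ³`, Leray–Hopf on `[0, 1]` from
its rapidly decaying datum `u 0`, obeying the Type-I rate `‖u(t, x)‖ ≤ C/√(1 - t)` for ALL
`t ∈ [0, 1)` (not just eventually), with NO classical extension past `1` (`target_iff_unit` +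
`globalRate_of_isTypeIBlowup`). By §4 such a `u` is then the maximal Kato solution from `u 0`,
has a singular point `(1, x₀)`, is not axisymmetric / backward self-similar / near-1-DSS-modelled,
its constant satisfies `C ≥ c_Leray` (`counterexample_typeI_constant_ge`), and it yields an
Albritton–Barker local Type-I singular point (§4b). -/
theorem not_target_iff_unit_witness :
    ¬ Target ↔ ∃ (u : ℝ → ℝ³ → ℝ³) (p : ℝ → ℝ³ → ℝ),
      IsClassicalNSSolutionOn (Ico 0 1) 1 0 u p ∧ IsLerayHopfOn 1 1 0 (u 0) u ∧
      HasRapidSpatialDecay (u 0) ∧ (∃ C : ℝ, ∀ t ∈ Ico (0 : ℝ) 1, ∀ x, ‖u t x‖ ≤ C / Real.sqrt (1 - t)) ∧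
      ¬ HasSmoothExtensionPast 1 0 u 1 := by
  rw [target_iff_unit]
  constructor
  · intro h
    by_contra hno
    refine h fun u p hcl hLH hdec hI => ?_
    by_contra hext
    exact hno ⟨u, p, hcl, hLH, hdec, globalRate_of_isTypeIBlowup one_pos one_pos hcl hLH hdec hI, hext⟩
  · rintro ⟨u, p, hcl, hLH, hdec, ⟨C, hC⟩, hext⟩ h
    refine hext (h u p hcl hLH hdec ⟨C, ?_⟩)
    filter_upwards [Ioo_mem_nhdsLT (zero_lt_one' ℝ)] with t ht x using hC t ⟨ht.1.le, ht.2⟩ x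

end KillNormalForm

end Summit.NavierStokesRegularity.NavierStokesRegularity.Theorems.Target.Negative

end
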